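import Literature.Barriers.HodgeConjecture.GeneralizedHodgeTrivialReasonsSubHodge
import Literature.AlgebraicGeometry.HodgeTheory.ComplexConjugation
import Literature.AlgebraicGeometry.HodgeTheory.RationalClassesIndependent
import HarnessLib

/-!
# Grothendieck (1969), p. 300: the parity argument PROVED from Hodge symmetry, and the
finiteness of the rational lattice DISCHARGED

Companion to `GeneralizedHodgeTrivialReasonsSubHodge` (sub-Hodge structures of a Hodge model,
`HodgeModel.IsSubHodge`, and the decomposition of the named fact
`Grothendieck1969_rationalSupportedClasses_evenRank` — Grothendieck, Topology 8 (1969), p. 300 —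
into its printed inputs: `…_supportedClasses_isSubHodge` [Deligne], the parity of a rational
sub-Hodge structure of odd weight [Hodge symmetry, PROVED here] and
`smoothProjective_rationalClasses_finiteRatBasis` [Betti finiteness, DISCHARGED here]). Pure
proofs:

* `smoothProjective_rationalClasses_finiteRatBasis_holds` — DISCHARGE of the finiteness fact:
  a `ℚ`-basis of `Hⁱ(X(ℂ); ℚ)` (finite-dimensional, `finite_singularCohomology_rat_complexPoints`,
  Hatcher App. A Cor. A.8–A.9 / §3.1 Cor. 3.3 on the compact manifold `X(ℂ)`) maps under
  `ζ ↦ [ζ ⊗ 1]` (`cocycleOfRat`) to a `ℚ`-basis of the rational classes of `Hⁱ(X(ℂ); ℂ)`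
  (`isRationalClass_iff_exists_cocycleOfRat`; unique coefficients by the injectivity
  `π_cocycleOfRat_eq_iff` of `Hⁱ(–; ℚ) → Hⁱ(–; ℂ)`), file `HodgeTheory/RationalLattice`.
* `even_of_isSubHodge_of_isHodgeSymmetric` — Grothendieck's second sentence ("If `i` is odd,
  this would imply for instance that the dimension over `ℚ` of that space is even") PROVED in
  any ONE Hodge model with `conj H^{p,q} ⊆ H^{q,p}` (`HodgeModel.IsHodgeSymmetric`, file
  `HodgeTheory/ComplexConjugation`; Hodge symmetry is part of the definition of a Hodge
  structure, Voisin I Def. 7.4, and holds for the Hodge structure of a compact Kähler manifold,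
  Cor. 6.12 — Grothendieck argues inside "the Hodge structure `Hⁱ(X^an, ℂ)`"): for a
  `ℚ`-independent family `b` of `r` rational classes with sub-Hodge span `W` (pulled back to the
  model), `b` is `ℂ`-independent (`linearIndependent_of_isRationalClass`), so `dim_ℂ W = r`;
  `W = ⨁ W ∩ H^{a,b}` with independent pieces (Hodge decomposition of the model), so
  `r = ∑_{a+b=i} dim W ∩ H^{a,b}`; `W` is stable under conjugation (spanned by real classes,
  `IsRationalClass.conjClass_eq`) and conjugation is a conjugate-linear bijection
  `W ∩ H^{a,b} ≃ W ∩ H^{b,a}`, so the summands are symmetric in `(a, b)`; for `i` odd, `a ≠ b`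
  and the sum is even. With `hodgePQ_independent_of_hodgeModel`, Hodge symmetry passes from one
  model to every model (`HodgeModel.IsHodgeSymmetric.of_hodgeModel`). No statement quantified
  over ARBITRARY Hodge models is kept (review of the decomposition, D-0026): the structure
  `HodgeModel` records the Hodge decomposition but not Hodge symmetry, and symmetry of an
  arbitrary model is the rigidity of natural de Rham comparisons
  (`HodgeTheory/HodgeSymmetryRigidity`, unprinted folklore after Thom 1954), which is no input
  of p. 300.
* `Grothendieck1969_rationalSupportedClasses_evenRank_of_isSubHodge_of_exists_isReal` — the
  vendored fact from the two named facts `Grothendieck1969_supportedClasses_isSubHodge`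
  (Deligne) and `exists_isReal_hodgeModel` (a Hodge model whose de Rham comparison is defined
  over `ℝ`, file `HodgeTheory/ComplexConjugation`; Hodge symmetry is PROVED for it from
  `Motives.conj_hodgePQ_eq`), via `…_of_exists_isHodgeSymmetric` (one Hodge symmetric model
  suffices). The residual trust base of `Grothendieck1969_rationalSupportedClasses_evenRank`
  is thus Deligne's theorem plus the standard (real) Hodge model.

## References

* [GrothendieckTopology1969] A. Grothendieck, Topology 8 (1969), p. 300.
* [VoisinHodgeI2002] C. Voisin, Hodge Theory and Complex Algebraic Geometry I, Cor. 6.12,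
  Cor. 6.13, Thm. 6.18 (§6.1.3), Def. 7.4 (§7.1.1), §7.3.1 (remark after Lemma 7.26).
* [HatcherAT2002] A. Hatcher, Algebraic Topology, §3.1 (Thm. 3.2, Cor. 3.3), App. A Cor. A.8–9.
-/

noncomputable section

open CategoryTheory

namespace Literature.Barriers.HodgeConjecture

section Barriers
section HodgeConjecture

open Literature.AlgebraicGeometry.HodgeTheory Literature.AlgebraicGeometry.Motives
  Literature.AlgebraicTopology.SingularHomology

/-! ### Discharge of the finiteness of the rational lattice -/

set_option backward.isDefEq.respectTransparency false in
/-- **DISCHARGE of `smoothProjective_rationalClasses_finiteRatBasis`**: for `X` smooth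
projective over `ℂ`, the rational classes of `Hⁱ(X(ℂ); ℂ)` have a finite `ℚ`-basis — the image
under `ζ ↦ [ζ ⊗ 1]` of a `ℚ`-basis of the finite-dimensional `Hⁱ(X(ℂ); ℚ)` (Hatcher App. A
Cor. A.8–A.9 and §3.1 Cor. 3.3 for the compact manifold `X(ℂ)`; injectivity of
`Hⁱ(–; ℚ) → Hⁱ(–; ℂ)` for the uniqueness of coefficients).
[cite: HatcherAT2002, App. A Cor. A.9 and §3.1 Cor. 3.3] -/
theorem smoothProjective_rationalClasses_finiteRatBasis_holds :
    smoothProjective_rationalClasses_finiteRatBasis := by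
  intro n X hX i
  haveI := finite_singularCohomology_rat_complexPoints hX i
  let β := Module.finBasis ℚ (singularCohomology ℚ ℚ (ComplexPoints X) i)
  have hsurj : Function.Surjective (singularCohomology.π ℚ ℚ (ComplexPoints X) i) :=
    (ModuleCat.epi_iff_surjective _).1 inferInstance
  choose ζ hζ using fun j ↦ hsurj (β j)
  -- the candidate basis: the classes of `ζ j ⊗ 1`
  have hcomb : ∀ q : Fin (Module.finrank ℚ (singularCohomology ℚ ℚ (ComplexPoints X) i)) → ℚ,
      ratComb (fun j ↦ singularCohomology.π ℂ ℂ _ i (cocycleOfRat _ i (ζ j))) q =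
        singularCohomology.π ℂ ℂ _ i (cocycleOfRat _ i (∑ j, q j • ζ j)) := by
    intro q
    simp only [ratComb, map_sum, cocycleOfRat_smul, map_smul]
  have hrat : ∀ q : Fin (Module.finrank ℚ (singularCohomology ℚ ℚ (ComplexPoints X) i)) → ℚ,
      singularCohomology.π ℚ ℚ _ i (∑ j, q j • ζ j) = β.equivFun.symm q := by
    intro q
    rw [map_sum, β.equivFun_symm_apply]
    exact Finset.sum_congr rfl fun j _ ↦ by rw [map_smul, hζ]
  refine ⟨_, fun j ↦ singularCohomology.π ℂ ℂ _ i (cocycleOfRat _ i (ζ j)), fun q ↦ ?_,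
    fun c hc ↦ ?_⟩
  · rw [Set.mem_setOf_eq, hcomb]
    exact isRationalClass_π_cocycleOfRat _
  · obtain ⟨ζ₀, rfl⟩ := IsRationalClass.exists_cocycleOfRat hc
    refine ⟨β.equivFun (singularCohomology.π ℚ ℚ _ i ζ₀), ?_, fun q hq ↦ ?_⟩
    · beta_reduce
      rw [hcomb, π_cocycleOfRat_eq_iff, hrat, LinearEquiv.symm_apply_apply]
    · beta_reduce at hq
      rw [hcomb, π_cocycleOfRat_eq_iff, hrat] at hq
      rw [← hq, LinearEquiv.apply_symm_apply]

/-! ### Linear algebra: dimension of a sub-Hodge structure, symmetry and parity -/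

section LinAlg

variable {K : Type*} [DivisionRing K] {H : Type*} [AddCommGroup H] [Module K H]

/-- Reindexing a double supremum over `p + q = k` by the antidiagonal (any complete lattice).
[folklore] -/
theorem iSup_add_eq_iSup_antidiagonal {α : Type*} [CompleteLattice α] (k : ℕ) (F : ℕ → ℕ → α) :
    ⨆ (p : ℕ) (q : ℕ) (_ : p + q = k), F p q =
      ⨆ pq : ↥(Finset.antidiagonal k), F pq.1.1 pq.1.2 := by
  refine le_antisymm (iSup_le fun p ↦ iSup_le fun q ↦ iSup_le fun hpq ↦ ?_) (iSup_le fun pq ↦ ?_)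
  · exact le_iSup_of_le (f := fun pq : ↥(Finset.antidiagonal k) ↦ F pq.1.1 pq.1.2)
      ⟨(p, q), Finset.mem_antidiagonal.2 hpq⟩ le_rfl
  · exact le_iSup_of_le pq.1.1 (le_iSup_of_le pq.1.2
      (le_iSup_of_le (Finset.mem_antidiagonal.1 pq.2) le_rfl))

/-- **The dimension of an internal direct sum of finitely many subspaces is the sum of the
dimensions**: if `W = ⨆ᵢ Pᵢ` with the `Pᵢ` independent and `W` finite-dimensional, then
`dim W = ∑ᵢ dim Pᵢ` (concatenate bases, `DirectSum.IsInternal.collectedBasis`), over any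
division ring. Variant of `Motives.finrank_biSup_eq_sum_of_iSupIndep`
(`Motives/HodgeTensorHodgeNumberProofs`) and `finrank_biSup_eq_sum_of_iSupIndep'`
(`NumberTheory/Automorphic/BigCellOpen`), which assume the AMBIENT space finite-dimensional;
here only the sum `W` is (the ambient `Hᵏ(X^an; ℂ)` carries no such instance) — for a
librarian to merge. [folklore] -/
theorem finrank_eq_sum_of_iSupIndep {ι : Type*} [Fintype ι] {P : ι → Submodule K H}
    (hP : iSupIndep P) {W : Submodule K H} [FiniteDimensional K W] (hW : W = ⨆ i, P i) :
    Module.finrank K W = ∑ i, Module.finrank K (P i) := by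
  classical
  subst hW
  set p : Submodule K H := ⨆ i, P i
  have hp : ∀ i, P i ≤ p := fun i ↦ le_iSup P i
  have hint : DirectSum.IsInternal fun i ↦ (P i).comap p.subtype := by
    refine (DirectSum.isInternal_submodule_iff_iSupIndep_and_iSup_eq_top _).mpr ⟨?_, ?_⟩
    · let e : Submodule K p ≃o Set.Iic p := p.mapIic
      suffices (e ∘ fun i ↦ (P i).comap p.subtype) = fun i ↦ ⟨P i, hp i⟩ by
        rw [← iSupIndep_map_orderIso_iff e, this]
        exact .of_coe_Iic_comp hP
      ext i m
      change m ∈ ((P i).comap p.subtype).map p.subtype ↔ _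
      rw [Submodule.map_comap_subtype, inf_of_le_right (hp i)]
    · apply Submodule.map_injective_of_injective p.injective_subtype
      rw [Submodule.map_iSup, Submodule.map_top, Submodule.range_subtype]
      exact iSup_congr fun i ↦ by rw [Submodule.map_comap_subtype, inf_of_le_right (hp i)]
  rw [Module.finrank_eq_card_basis
    (hint.collectedBasis fun i ↦ Module.finBasis K ((P i).comap p.subtype)), Fintype.card_sigma]
  refine Finset.sum_congr rfl fun i _ ↦ ?_
  rw [Fintype.card_fin, (Submodule.comapSubtypeEquivOfLe (hp i)).finrank_eq]

/-- **Conjugation matches the pieces of a real subspace**: if `W ⊆ Hᵏ(Y; ℂ)` is stable under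
complex conjugation and conjugation maps `U` into `V` and `V` into `U`, then
`dim (W ∩ U) = dim (W ∩ V)` — `conj` restricts to a conjugate-linear bijection
`W ∩ U ≃ W ∩ V`, and dimension is invariant under semilinear bijections
(`rank_eq_of_equiv_equiv`). [cite: VoisinHodgeI2002, Cor. 6.12] -/
theorem finrank_inf_eq_of_conjClass {Y : Type*} [TopologicalSpace Y] {k : ℕ}
    (W U V : Submodule ℂ (singularCohomology ℂ ℂ Y k))
    (hW : ∀ c ∈ W, conjClass Y k c ∈ W) (hUV : ∀ c ∈ U, conjClass Y k c ∈ V)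
    (hVU : ∀ c ∈ V, conjClass Y k c ∈ U) :
    Module.finrank ℂ ↥(W ⊓ U) = Module.finrank ℂ ↥(W ⊓ V) := by
  let e : ↥(W ⊓ U) ≃+ ↥(W ⊓ V) :=
    { toFun := fun x ↦ ⟨conjClass Y k x, hW _ x.2.1, hUV _ x.2.2⟩
      invFun := fun x ↦ ⟨conjClass Y k x, hW _ x.2.1, hVU _ x.2.2⟩
      left_inv := fun x ↦ by ext; exact conjClass_conjClass _
      right_inv := fun x ↦ by ext; exact conjClass_conjClass _
      map_add' := fun x y ↦ by ext; exact conjClass_add _ _ }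
  unfold Module.finrank
  rw [rank_eq_of_equiv_equiv (starRingEnd ℂ) e
    (Function.Involutive.bijective fun c ↦ starRingEnd_self_apply c)
    (fun a x ↦ by ext; exact conjClass_smul a _)]

/-- A symmetric function on the antidiagonal of an ODD number has even sum: the involution
`(a, b) ↦ (b, a)` has no fixed point, so the sum is twice the sum over `a < b`. [folklore] -/
theorem even_sum_antidiagonal_of_symm {k : ℕ} (hk : Odd k) (f : ℕ × ℕ → ℕ)
    (hf : ∀ p q, p + q = k → f (p, q) = f (q, p)) :
    Even (∑ pq ∈ Finset.antidiagonal k, f pq) := by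
  obtain ⟨m, rfl⟩ := hk
  rw [← Finset.sum_filter_add_sum_filter_not _ (fun pq : ℕ × ℕ ↦ pq.1 < pq.2)]
  have hswap : ∑ pq ∈ (Finset.antidiagonal (2 * m + 1)).filter (fun pq ↦ ¬ pq.1 < pq.2), f pq =
      ∑ pq ∈ (Finset.antidiagonal (2 * m + 1)).filter (fun pq ↦ pq.1 < pq.2), f pq := by
    refine Finset.sum_nbij' Prod.swap Prod.swap ?_ ?_ (fun _ _ ↦ Prod.swap_swap _)
      (fun _ _ ↦ Prod.swap_swap _) ?_
    · intro pq hpq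
      simp only [Finset.mem_filter, Finset.mem_antidiagonal, Prod.fst_swap, Prod.snd_swap]
        at hpq ⊢
      omega
    · intro pq hpq
      simp only [Finset.mem_filter, Finset.mem_antidiagonal, Prod.fst_swap, Prod.snd_swap]
        at hpq ⊢
      omega
    · intro pq hpq
      simp only [Finset.mem_filter, Finset.mem_antidiagonal] at hpq
      exact hf pq.1 pq.2 hpq.1
  rw [hswap, ← two_mul]
  exact even_two_mul _

end LinAlg

/-! ### The second input of p. 300, proved from Hodge symmetry -/

/-- The pieces `H^{p,q}`, `p + q = k`, of a Hodge model are independent in `Hᵏ(X^an; ℂ)`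
(Hodge decomposition of the model, field `isInternal_hodgePQ`, transported along the de Rham
comparison). Dot-notation extension of `HodgeTheory.HodgeModel` declared from the barrier
catalogue (first consumer). [cite: VoisinHodgeI2002, Thm. 6.18 and Cor. 6.14] -/
theorem _root_.Literature.AlgebraicGeometry.HodgeTheory.HodgeModel.iSupIndep_hodgePQ {n : ℕ}
    {X : SchemeOver ℂ} (A : HodgeModel n X) (k : ℕ) :
    iSupIndep fun pq : ↥(Finset.antidiagonal k) ↦ A.hodgePQ k pq.1.1 pq.1.2 :=
  (iSupIndep_map_orderIso_iff (Submodule.orderIsoMapComap (A.deRham A.carrier k))).2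
    (A.isInternal_hodgePQ k).submodule_iSupIndep

set_option backward.isDefEq.respectTransparency false in
/-- **The parity argument in ONE Hodge symmetric model** (Grothendieck 1969, p. 300: "If `i` is
odd, this would imply for instance that the dimension over `ℚ` of that space is even"). Let
`A` be a Hodge model of `X` in which `conj H^{p,q} ⊆ H^{q,p}` (`HodgeModel.IsHodgeSymmetric`,
Voisin I Cor. 6.12), `i` odd, and `b` a `ℚ`-independent family of `r` rational classes of
`Hⁱ(X(ℂ); ℂ)` whose complex span, pulled back to `A`, is a sub-Hodge structure `W`. Then `r`
is even: `dim_ℂ W = r` (rational classes independent over `ℚ` are independent over `ℂ`,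
`linearIndependent_of_isRationalClass`, file `HodgeTheory/RationalClassesIndependent`);
`r = ∑_{a+b=i} dim W ∩ H^{a,b}` (independent pieces,
`finrank_eq_sum_of_iSupIndep`); `dim W ∩ H^{a,b} = dim W ∩ H^{b,a}` (`W` is spanned by real
classes, `finrank_inf_eq_of_conjClass`); `a ≠ b` as `i` is odd (`even_sum_antidiagonal_of_symm`).
No hypothesis on `X` is needed. [cite: GrothendieckTopology1969, p. 300] [cite: VoisinHodgeI2002, Cor. 6.12 and Cor. 6.13] -/
theorem even_of_isSubHodge_of_isHodgeSymmetric {n : ℕ} {X : SchemeOver ℂ} {A : HodgeModel n X}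
    (hS : A.IsHodgeSymmetric) {i : ℕ} (hi : Odd i) {r : ℕ} {b : Fin r → complexBetti X i}
    (hb : ∀ j, IsRationalClass (b j)) (hind : ∀ q : Fin r → ℚ, ratComb b q = 0 → q = 0)
    (hW : A.IsSubHodge i ((Submodule.span ℂ (Set.range b)).map (A.pullback i).hom)) :
    Even r := by
  -- rational classes without rational relations are `ℂ`-independent
  have hC : LinearIndependent ℂ b := linearIndependent_of_isRationalClass hb hind
  -- pull back to the model
  set b' : Fin r → singularCohomology ℂ ℂ A.carrier i := fun j ↦ A.pullback i (b j) with hb'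
  have hb'rat : ∀ j, IsRationalClass (b' j) := fun j ↦ (hb j).map _
  have hC' : LinearIndependent ℂ b' :=
    hC.map' (A.pullback i).hom (LinearMap.ker_eq_bot.2 (A.pullback_injective i))
  set W := Submodule.span ℂ (Set.range b') with hWdef
  have hWmap : (Submodule.span ℂ (Set.range b)).map (A.pullback i).hom = W := by
    rw [Submodule.map_span, ← Set.range_comp]
    rfl
  rw [hWmap] at hW
  haveI : FiniteDimensional ℂ W := FiniteDimensional.span_of_finite ℂ (Set.finite_range b')
  have hrank : Module.finrank ℂ W = r := by
    rw [hWdef, finrank_span_eq_card hC', Fintype.card_fin]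
  -- the pieces `W ∩ H^{a,b}`
  have hP : iSupIndep fun pq : ↥(Finset.antidiagonal i) ↦ W ⊓ A.hodgePQ i pq.1.1 pq.1.2 :=
    (A.iSupIndep_hodgePQ i).mono fun _ ↦ inf_le_right
  have hWP : W = ⨆ pq : ↥(Finset.antidiagonal i), W ⊓ A.hodgePQ i pq.1.1 pq.1.2 :=
    hW.trans (iSup_add_eq_iSup_antidiagonal i fun p q ↦ W ⊓ A.hodgePQ i p q)
  have hsum := finrank_eq_sum_of_iSupIndep hP hWP
  -- symmetry of the pieces under conjugation
  have hWconj : ∀ c ∈ W, conjClass A.carrier i c ∈ W := fun c hc ↦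
    conjClass_mem_span_of_isRationalClass hb'rat hc
  have hsymm : ∀ p q, p + q = i →
      Module.finrank ℂ ↥(W ⊓ A.hodgePQ i p q) = Module.finrank ℂ ↥(W ⊓ A.hodgePQ i q p) :=
    fun p q _ ↦ finrank_inf_eq_of_conjClass W _ _ hWconj (fun c hc ↦ hS i p q c hc)
      (fun c hc ↦ hS i q p c hc)
  -- parity
  have heven : Even (∑ pq : ↥(Finset.antidiagonal i),
      Module.finrank ℂ ↥(W ⊓ A.hodgePQ i pq.1.1 pq.1.2)) := by
    rw [Finset.sum_coe_sort (Finset.antidiagonal i)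
      (fun pq ↦ Module.finrank ℂ ↥(W ⊓ A.hodgePQ i pq.1 pq.2))]
    exact even_sum_antidiagonal_of_symm hi _ fun p q hpq ↦ hsymm p q hpq
  rwa [← hsum, hrank] at heven

/-- **Hodge symmetry passes from one Hodge model to all**, given the named fact
`hodgePQ_independent_of_hodgeModel` (all models of a smooth projective `X` induce the same
pieces on `Hᵏ(X(ℂ); ℂ)`; `HodgeTheory/HodgeFiltrationModels`) and the naturality of
conjugation (`conjClass_map`): test membership on `Hᵏ(X(ℂ); ℂ)` through the bijective
pull-backs. (The follow-up suggested in the review of `HodgeTheory/ComplexConjugation`.)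
[cite: VoisinHodgeI2002, Cor. 6.12 and Prop. 6.11] -/
theorem _root_.Literature.AlgebraicGeometry.HodgeTheory.HodgeModel.IsHodgeSymmetric.of_hodgeModel
    (hI : hodgePQ_independent_of_hodgeModel) {n : ℕ} {X : SchemeOver ℂ}
    (hX : IsSmoothProjective n X) {A₀ : HodgeModel n X} (h₀ : A₀.IsHodgeSymmetric)
    (A : HodgeModel n X) : A.IsHodgeSymmetric := by
  intro k p q c hc
  obtain ⟨c₀, rfl⟩ := A.pullback_surjective k c
  have h₁ : conjClass A₀.carrier k (A₀.pullback k c₀) ∈ A₀.hodgePQ k q p :=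
    h₀ k p q _ (hI n X hX A A₀ k p q c₀ hc)
  have e₀ : conjClass A₀.carrier k (A₀.pullback k c₀) = A₀.pullback k (conjClass _ k c₀) :=
    conjClass_map _ c₀
  have e : conjClass A.carrier k (A.pullback k c₀) = A.pullback k (conjClass _ k c₀) :=
    conjClass_map _ c₀
  rw [e₀] at h₁
  rw [e]
  exact hI n X hX A₀ A k q p _ h₁

/-! ### Assembly: the vendored fact from Deligne's theorem and a real Hodge model -/

/-- **`Grothendieck1969_rationalSupportedClasses_evenRank` in one Hodge symmetric model**: the
sub-Hodge property of the coniveau classes (`Grothendieck1969_supportedClasses_isSubHodge`,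
Grothendieck p. 300 / Deligne) and the existence, for every smooth projective `X`, of ONE
Hodge model with `conj H^{p,q} ⊆ H^{q,p}` imply the vendored fact; the finiteness of the
rational lattice is discharged (`smoothProjective_rationalClasses_finiteRatBasis_holds`) and the
parity step proved (`even_of_isSubHodge_of_isHodgeSymmetric`).
[cite: GrothendieckTopology1969, p. 300] -/
theorem Grothendieck1969_rationalSupportedClasses_evenRank_of_isSubHodge_of_exists_isHodgeSymmetric
    (hA : Grothendieck1969_supportedClasses_isSubHodge)
    (hS : ∀ (n : ℕ) (X : SchemeOver ℂ), IsSmoothProjective n X →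
      ∃ A : HodgeModel n X, A.IsHodgeSymmetric) :
    Grothendieck1969_rationalSupportedClasses_evenRank := by
  intro n X hX i p hi
  obtain ⟨A, hAS⟩ := hS n X hX
  obtain ⟨r, b, hb⟩ := exists_isRatBasisOn_ratSupportedClasses
    smoothProjective_rationalClasses_finiteRatBasis_holds hX i p
  have heven : Even r :=
    even_of_isSubHodge_of_isHodgeSymmetric hAS hi (fun j ↦ (hb.mem j).1)
      (fun _ hq ↦ hb.eq_zero hq) (hb.span_eq ▸ hA n X hX A i p)
  obtain ⟨m, hm⟩ := heven
  refine ⟨m, ?_⟩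
  rw [two_mul, ← hm]
  exact ⟨b, hb⟩

/-- **`Grothendieck1969_rationalSupportedClasses_evenRank` from the tree's two named facts**:
Deligne's theorem in Grothendieck's form (`Grothendieck1969_supportedClasses_isSubHodge`: the
coniveau classes span a sub-Hodge structure) and the existence of a REAL Hodge model
(`exists_isReal_hodgeModel`: analytification + de Rham comparison defined over `ℝ` + Hodge
decomposition; Serre, de Rham, Hodge), Hodge symmetry being PROVED for real models
(`HodgeModel.IsReal.isHodgeSymmetric`, from `Motives.conj_hodgePQ_eq`). This is the residual
trust base of the vendored fact. [cite: GrothendieckTopology1969, p. 300]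
[cite: VoisinHodgeI2002, Cor. 6.12 and Cor. 6.13] -/
theorem Grothendieck1969_rationalSupportedClasses_evenRank_of_isSubHodge_of_exists_isReal
    (hA : Grothendieck1969_supportedClasses_isSubHodge) (hR : exists_isReal_hodgeModel) :
    Grothendieck1969_rationalSupportedClasses_evenRank :=
  Grothendieck1969_rationalSupportedClasses_evenRank_of_isSubHodge_of_exists_isHodgeSymmetric hA
    fun _ _ hX ↦ hR.exists_isHodgeSymmetric hX

/-- Sanity instance `p = 0` under the same two facts: ALL rational classes of `Hⁱ(X(ℂ); ℂ)`,
`i` odd, `X` smooth projective, have a `ℚ`-basis of even size — "the odd Betti numbers of a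
compact Kähler manifold are even" (Voisin I, Cor. 6.13). [cite: VoisinHodgeI2002, Cor. 6.13] -/
theorem exists_even_isRatBasisOn_rationalClasses_of_isSubHodge_of_exists_isReal
    (hA : Grothendieck1969_supportedClasses_isSubHodge) (hR : exists_isReal_hodgeModel) {n : ℕ}
    {X : SchemeOver ℂ} (hX : IsSmoothProjective n X) {i : ℕ} (hi : Odd i) :
    ∃ (m : ℕ) (b : Fin (2 * m) → complexBetti X i),
      IsRatBasisOn {c : complexBetti X i | IsRationalClass c} b := by
  simpa [supportedClasses_zero] using
    Grothendieck1969_rationalSupportedClasses_evenRank_of_isSubHodge_of_exists_isReal hA hR n X hX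
      i 0 hi

end HodgeConjecture
end Barriers

end Literature.Barriers.HodgeConjecture

end
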